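import Summits.QuantumFields.YangMills.Statement
import Summits.QuantumFields.YangMills.Theorems.LangevinControlUVOSLegsAtWeakCouplingCSketchRetype
import Literature.MathematicalPhysics.QuantumFieldTheory.YangMillsOSOneSpecies
import Literature.MathematicalPhysics.QuantumFieldTheory.Balaban1983to89.CrossoverLedger
import Literature.MathematicalPhysics.QuantumFieldTheory.BlockScaleEffectivePerturbation
import Summits.Ventures.YMGap.RobustBall.TorusRowsSU2StarW
import Summits.QuantumFields.YangMills.Theorems.LangevinControlUVOSLegsFromFemtoAndGapDefs
import HarnessLib

/-!
# OSLegsAtWeakCouplingC / Y2Bridge (1/3) — the four binders `UV, NT, IR, ROT` and King's finite-angle E1 leg `KING Θ`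

HONEST FRAMING (cell `ym-beyond`, seat P2 «strong-coupling bridge», HUMAN RULING D-0035 / D-0037; tree edition g9,
2026-08-25, module 1 of 3 of the farm-checked HOME text `ROUTE-P2-Lift-Y2Bridge.lean` sha16 88dea3089e2d7187 = sketches
`ROUTE-P2-SketchY2v2.lean` 41ff3c804614185f + `ROUTE-P2-SketchSeq.lean` 71a1ab5bc548f5fc, referee baseline v0.7 PASS; memo
`HOME/ROUTE-P2.md` §4f, §5; filed for the cell by the courier seat `ym-beyond-courier` per director-ym lines №1 (A), №3 (C)).  SUMMIT-SIDE SUPPORT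
for the lead of crux `OSLegsAtWeakCouplingC`: NOTHING here is asserted about Yang–Mills — every binder is a HYPOTHESIS,
a statement about LATTICE Yang–Mills alone (Wilson's measure on odd tori `(ℤ/(2L+1))⁴`, tree coupling `β`, unit map
`a : ℝ → ℝ`) taken verbatim from the tree (`Cruxes.OSLegsFromFemtoAndGap.DlrCollarTransfer.*`,
`Theorems/LangevinControlUVOSLegsFromFemtoAndGapDefs.lean`, `…AtWeakCouplingCSketchRetype.lean`); every arrow is a TREE
theorem used by name; no item is tagged or registered (the route owner's call).  NO `sorry`, no axiom beyond the
standard three.  WHAT THIS IS NOT: not a proof of any leg, not THE NUMBER (memo §2), not the venture-side door modules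
(`Summits/Ventures/YMGap/YM4Door/*`).

CONTENTS.  §Binders: `UV := MomentBounds6 G r a` (a-UNIFORM E0′, hyperscaling `a⁴` per insertion); `NT := LowerBounds G r a`
(k-free lower bounds for the smeared truncated two-point / connected three-point functions); `IR := GapInUnits G r a`
(the volume-uniform lattice mass gap `≥ c₁` in physical units for ALL large `β` — where the crossover NUMBER lives: the
certified strong-coupling bank delivers this shape only for `β_W,eff ≤ 1/3`, `SU(2)`); `ROT := LatticeRotWard G r a` (E1 in
LATTICE form — verbatim the hypothesis `hlat` of the tree's `conclC_of_legs_latticeWard`; NECESSARY, tree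
`conclC_imp_latticeRotationDefect`).  §King: the mechanism of King (Commun. Math. Phys. 103 (1986) 323, Thm 2.4, for
U(1) Higgs₂) in tree vocabulary — orbit functions of a density-bounded functional are continuous (`continuous_orbit`, from
`GermWard.hasDerivAt_orbit_zero`), finite-angle invariance on a set of angles generating a DENSE subgroup makes them
constant (`orbit_eq_of_king`), hence a det-1 planar-invariant germ (`germInvariant_planeRot_of_king`) and the germ input of
the bridge from finite-angle LATTICE defects (`germRotAt_of_latticeKingAt`); King's own angle set, the Pythagorean angles,
is a dense additive subgroup (`pythagoreanAngles`, `dense_pythagoreanAngles`).  §BindersKing: `KING Θ := LatticeKingWard G r a Θ`.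
NEXT: `Y2BridgeClay.lean` (the bridge at one group and to the Clay decl; sequential IR leg), `Y2BridgeWindow.lean` (the P2
window inside the bridge; the SU(2) instance).

References: K. Osterwalder, E. Seiler, Ann. Phys. 110 (1978) 440–471; C. King, CMP 103 (1986) 323–349; the tree files above.
-/

set_option autoImplicit false

noncomputable section

open scoped SchwartzMap ComplexConjugate BigOperators
open MeasureTheory Filter Topology
open Literature.MathematicalPhysics.QuantumFieldTheory Literature.MathematicalPhysics.QuantumLattice
open Literature.MathematicalPhysics.AQFT Literature.Probability.LatticeModels
open Summit.QuantumFields.YangMills.Cruxes.OSLegsFromFemtoAndGap.DlrCollarTransfer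
open Summit.QuantumFields.YangMills.Cruxes.OSLegsAtWeakCouplingC.Sketch
open Summit.QuantumFields.YangMills.Theorems.OSLegsFromFemtoAndGap (isHermitian_of_isReflectionPositive latticeDist)
open Summit.QuantumFields.YangMills.Theorems.HypercubicLimit.Negative (onlySpecies latticeSchwinger_onlySpecies_self)
open Summit.QuantumFields.YangMills.Theorems.NPointIsotropy.Negative (E4)

namespace Summit.QuantumFields.YangMills.Cruxes.OSLegsAtWeakCouplingC.Y2Bridge

section Binders

variable (G : Type) [Group G] [TopologicalSpace G] [IsTopologicalGroup G] [CompactSpace G]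
  [MeasurableSpace G] [BorelSpace G] (r : LatticeRep G) (a : ℝ → ℝ)

/-- **UV** — a-uniform E0′ (hyperscaling) on every odd torus: the tree's `MomentBounds6`. -/
abbrev UV : Prop := MomentBounds6 G r a

/-- **NT** — lattice-side non-triviality and non-Gaussianity witnesses, k-free on large tori: the tree's `LowerBounds`. -/
abbrev NT : Prop := LowerBounds G r a

/-- **IR** — volume-uniform exponential clustering at rate `c₁·a(β)` for all `β ≥ β₂`: the tree's `GapInUnits`. -/
abbrev IR : Prop := GapInUnits G r a

/-- **ROT** — E1 in lattice form: the rotation-Ward defect of the centred, `a⁻⁴`-renormalised lattice `n`-point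
distributions tends to `0` along every scheme in units `a` with `β_k → ∞` and the soft-bundle torus ranges
(verbatim the hypothesis `hlat` of the tree's `conclC_of_legs_latticeWard`). -/
def LatticeRotWard : Prop :=
  ∀ (sch : SpeciesScheme (YMSpecies G)), (∀ k, sch.a k = a (sch.β k)) → Tendsto sch.β atTop atTop →
    (∀ k, 0 ≤ sch.β k ∧ sch.a k ≤ 1 / 24 ∧ 14 ≤ sch.L k ∧ (sch.a k)⁻¹ * (sch.a k)⁻¹ ≤ sch.L k) →
      ∃ r₀ : ℝ, 0 < r₀ ∧ ∀ (n : ℕ), 2 ≤ n → ∀ (F D : 𝓢((Fin n → E4), ℂ)), IsOffDiagonal F →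
        HasCompactSupport (F : (Fin n → E4) → ℂ) →
        (∃ δ : ℝ, 0 < δ ∧ tsupport (F : (Fin n → E4) → ℂ) ⊆ Separated n δ) →
        tsupport (F : (Fin n → E4) → ℂ) ⊆ SmallDiam n r₀ →
        (∀ x, D x = fderiv ℝ (F : (Fin n → E4) → ℂ) x
          (fun k => (x k 0) • (EuclideanSpace.single 1 1 : E4) - (x k 1) • (EuclideanSpace.single 0 1 : E4))) →
        Tendsto (fun k => latticeDist r.ρ (sch.β k) (sch.L k) (sch.a k) r.curvature.F
          (wilsonTorusMean r.ρ (sch.β k) (sch.L k) r.curvature.F) n D) atTop (𝓝 0)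

/-- **ROT** (abbreviation used in the bridge). -/
abbrev ROT : Prop := LatticeRotWard G r a

end Binders

/-! ## King-type E1 leg: finite-angle lattice rotation defects on a generating set of angles

Mechanism of King (Commun. Math. Phys. 103 (1986) 323, Thm 2.4, for U(1) Higgs₂): compare the lattice theory with
its copy on a lattice rotated by a PYTHAGOREAN angle and show the smeared `n`-point functions differ by `o(1)`;
invariance of the limit under a dense subgroup of SO(2) plus continuity gives rotation invariance.  Below, the
continuity is supplied by the tree's density bound off the diagonal (`OffDiagDensity`, landed `stub_density`) through
the differentiability of orbit functions (`GermWard.hasDerivAt_orbit_zero`), and the passage lattice → limit by the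
soft bundle's convergence clause on `⁰𝒮`.  Tree vocabulary only. -/

namespace King

open Set Metric
open Summit.QuantumFields.YangMills.Cruxes.OSLegsAtWeakCouplingC.Sketch.GermWard
open Summit.QuantumFields.YangMills.Theorems.OSLegsFromFemtoAndGap (exists_offDiagonal_cutoff_tendsto')
open Summit.QuantumFields.YangMills.Theorems.OSLegsAtWeakCouplingC
  (linActMulti_hasCompactSupport tsupport_linActMulti_subset_separated exists_pairCutoff_tendsto)
open Summit.QuantumFields.YangMills.Theorems.OSLegsFromFemtoAndGap.Upgrade (isOffDiagonal_linActMulti)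
open Summit.QuantumFields.YangMills.Theorems.NPointIsotropy.ComplexRotationBandlimit.Mopup (exists_eq_planeRot)
open Summit.QuantumFields.YangMills.Theorems.CurvatureBoostCovariance.BoostsInheritMirrors.OrbitBandlimit
  (linActMulti_planeRot_add)

variable {n : ℕ}

/-- **Orbit functions of a density-bounded functional are continuous**: for `S₁` with the density bound on compactly
supported `δ`-separated test functions and such an `F`, `θ ↦ S₁ n (R_θ · F)` is differentiable at every angle
(`GermWard.hasDerivAt_orbit_zero` at the rotated function, transported by the group law), hence continuous. -/
theorem continuous_orbit (S₁ : SchwingerFamily E4) (hdens : OffDiagDensity S₁) (F : 𝓢((Fin n → E4), ℂ))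
    (hFc : HasCompactSupport (F : (Fin n → E4) → ℂ)) {δ : ℝ} (hδ : 0 < δ)
    (hFδ : tsupport (F : (Fin n → E4) → ℂ) ⊆ Separated n δ) :
    Continuous fun θ : ℝ => S₁ n (linActMulti (planeRot (0 : Fin 3) θ) F) := by
  obtain ⟨B, hB⟩ := hdens n δ hδ
  set φ : ℝ → ℂ := fun θ => S₁ n (linActMulti (planeRot (0 : Fin 3) θ) F) with hφ
  have hderiv : ∀ θ₀ : ℝ, ∃ c : ℂ, HasDerivAt φ c θ₀ := by
    intro θ₀
    set F' : 𝓢((Fin n → E4), ℂ) := linActMulti (planeRot (0 : Fin 3) θ₀) F with hF'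
    have hF'c : HasCompactSupport (F' : (Fin n → E4) → ℂ) := linActMulti_hasCompactSupport _ hFc
    have hF'δ : tsupport (F' : (Fin n → E4) → ℂ) ⊆ Separated n δ := tsupport_linActMulti_subset_separated _ hFδ
    obtain ⟨D', hD'⟩ := exists_schwartz_rotDeriv F'
    have h0 : HasDerivAt (fun h : ℝ => S₁ n (linActMulti (planeRot (0 : Fin 3) h) F')) (S₁ n D') 0 :=
      hasDerivAt_orbit_zero S₁ hB F' D' hF'c hF'δ hD'
    have heq : (fun h : ℝ => S₁ n (linActMulti (planeRot (0 : Fin 3) h) F')) = fun h => φ (θ₀ + h) := by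
      funext h
      simp only [hφ, hF', linActMulti_planeRot_add]
    rw [heq] at h0
    refine ⟨S₁ n D', ?_⟩
    have hinner : HasDerivAt (fun θ' : ℝ => θ' - θ₀) 1 θ₀ := (hasDerivAt_id' θ₀).sub_const θ₀
    have h0' : HasDerivAt (fun h : ℝ => φ (θ₀ + h)) (S₁ n D') ((fun θ' : ℝ => θ' - θ₀) θ₀) := by
      simp only [sub_self]; exact h0
    have h1 : HasDerivAt ((fun h : ℝ => φ (θ₀ + h)) ∘ (fun θ' : ℝ => θ' - θ₀)) ((1 : ℝ) • S₁ n D') θ₀ :=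
      HasDerivAt.scomp (𝕜 := ℝ) θ₀ h0' hinner
    rw [one_smul] at h1
    refine h1.congr_of_eventuallyEq (Eventually.of_forall fun θ' => ?_)
    show φ θ' = φ (θ₀ + (θ' - θ₀))
    congr 1
    ring
  have hdiff : Differentiable ℝ φ := fun θ₀ => (hderiv θ₀).choose_spec.differentiableAt
  exact hdiff.continuous

/-- The class of test functions on which finite-angle identities are asked on the germ of diameter `r₀`: off-diagonal,
compactly supported, separated, of small diameter.  It is stable under every linear isometry acting diagonally. -/
def KingClass (n : ℕ) (r₀ : ℝ) : Set 𝓢((Fin n → E4), ℂ) :=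
  {F | IsOffDiagonal F ∧ HasCompactSupport (F : (Fin n → E4) → ℂ) ∧
    (∃ δ : ℝ, 0 < δ ∧ tsupport (F : (Fin n → E4) → ℂ) ⊆ Separated n δ) ∧
    tsupport (F : (Fin n → E4) → ℂ) ⊆ SmallDiam n r₀}

/-- `KingClass n r₀` is stable under every linear isometry of `ℝ⁴` acting diagonally (`linActMulti`). -/
theorem linActMulti_mem_kingClass {r₀ : ℝ} {F : 𝓢((Fin n → E4), ℂ)} (hF : F ∈ KingClass n r₀)
    (R : E4 ≃ₗᵢ[ℝ] E4) : linActMulti R F ∈ KingClass n r₀ := by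
  obtain ⟨hFo, hFc, ⟨δ, hδ, hFδ⟩, hFr⟩ := hF
  exact ⟨isOffDiagonal_linActMulti R hFo, linActMulti_hasCompactSupport R hFc,
    ⟨δ, hδ, tsupport_linActMulti_subset_separated R hFδ⟩, tsupport_linActMulti_subset_smallDiam R hFr⟩

/-- **Finite-angle invariance on a generating set of angles makes the orbit functions constant** (King's density
step, for a distribution with bounded densities off the diagonal): the stabiliser of the class is an additive subgroup
of the angles, closed by `continuous_orbit`, containing `Θ`; if `Θ` generates a dense subgroup it is all of `ℝ`. -/
theorem orbit_eq_of_king (S₁ : SchwingerFamily E4) (hdens : OffDiagDensity S₁) {r₀ : ℝ} {Θ : Set ℝ}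
    (hΘ : Dense ((AddSubgroup.closure Θ : AddSubgroup ℝ) : Set ℝ))
    (hking : ∀ F ∈ KingClass n r₀, ∀ θ ∈ Θ, S₁ n (linActMulti (planeRot (0 : Fin 3) θ) F) = S₁ n F)
    (F : 𝓢((Fin n → E4), ℂ)) (hF : F ∈ KingClass n r₀) (θ : ℝ) :
    S₁ n (linActMulti (planeRot (0 : Fin 3) θ) F) = S₁ n F := by
  -- the stabiliser of the class: an additive subgroup of the angles …
  let H : AddSubgroup ℝ :=
    { carrier := {θ : ℝ | ∀ F ∈ KingClass n r₀, S₁ n (linActMulti (planeRot (0 : Fin 3) θ) F) = S₁ n F}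
      zero_mem' := fun F _ => by rw [linActMulti_planeRot_zero]
      add_mem' := fun {θ₁ θ₂} h₁ h₂ F hF => by
        show S₁ n (linActMulti (planeRot (0 : Fin 3) (θ₁ + θ₂)) F) = S₁ n F
        rw [linActMulti_planeRot_add, h₂ _ (linActMulti_mem_kingClass hF _), h₁ F hF]
      neg_mem' := fun {θ} h F hF => by
        show S₁ n (linActMulti (planeRot (0 : Fin 3) (-θ)) F) = S₁ n F
        have h' := h _ (linActMulti_mem_kingClass hF (planeRot (0 : Fin 3) (-θ)))
        rw [← linActMulti_planeRot_add, neg_add_cancel, linActMulti_planeRot_zero] at h'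
        exact h'.symm }
  have hcoe : (H : Set ℝ) =
      {θ : ℝ | ∀ F ∈ KingClass n r₀, S₁ n (linActMulti (planeRot (0 : Fin 3) θ) F) = S₁ n F} := rfl
  -- … closed, by continuity of the orbit functions …
  have hHc : IsClosed (H : Set ℝ) := by
    have hH : (H : Set ℝ) = ⋂ (F : 𝓢((Fin n → E4), ℂ)) (_ : F ∈ KingClass n r₀),
        {θ : ℝ | S₁ n (linActMulti (planeRot (0 : Fin 3) θ) F) = S₁ n F} := by
      rw [hcoe]
      ext θ
      simp only [Set.mem_setOf_eq, Set.mem_iInter]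
    rw [hH]
    refine isClosed_biInter fun F hF => ?_
    obtain ⟨-, hFc, ⟨δ, hδ, hFδ⟩, -⟩ := hF
    exact isClosed_eq (continuous_orbit S₁ hdens F hFc hδ hFδ) continuous_const
  -- … containing `Θ`, hence the dense subgroup generated by it: it is everything
  have hΘH : Θ ⊆ (H : Set ℝ) := fun θ hθ =>
    show ∀ F ∈ KingClass n r₀, S₁ n (linActMulti (planeRot (0 : Fin 3) θ) F) = S₁ n F from
      fun F hF => hking F hF θ hθ
  have hcl : ((AddSubgroup.closure Θ : AddSubgroup ℝ) : Set ℝ) ⊆ (H : Set ℝ) := fun θ hθ =>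
    (AddSubgroup.closure_le H).2 hΘH hθ
  have huniv : (H : Set ℝ) = Set.univ := by
    rw [← hHc.closure_eq]
    exact (hΘ.mono hcl).closure_eq
  have hθ : θ ∈ (H : Set ℝ) := by
    rw [huniv]
    exact Set.mem_univ θ
  exact (show ∀ F ∈ KingClass n r₀, S₁ n (linActMulti (planeRot (0 : Fin 3) θ) F) = S₁ n F from hθ) F hF

/-- **Germ invariance under the plane rotations from finite-angle invariance on a generating set of angles** — the
King-type replacement of `GermWard.germInvariant_planeRot_of_ward`: same density closure of the class inside the germ
(landed cutoffs `exists_offDiagonal_cutoff_tendsto'`, `exists_pairCutoff_tendsto`), with `orbit_eq_of_king` in place of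
`orbit_eq_of_ward`. -/
theorem germInvariant_planeRot_of_king (S₁ : SchwingerFamily E4) (hdens : OffDiagDensity S₁)
    (h1 : ∀ F : 𝓢((Fin 1 → E4), ℂ), S₁ 1 F = 0) {r₀ : ℝ} {Θ : Set ℝ}
    (hΘ : Dense ((AddSubgroup.closure Θ : AddSubgroup ℝ) : Set ℝ))
    (hking : ∀ (n : ℕ), 2 ≤ n → ∀ F ∈ KingClass n r₀, ∀ θ ∈ Θ,
      S₁ n (linActMulti (planeRot (0 : Fin 3) θ) F) = S₁ n F)
    (θ : ℝ) : GermInvariant S₁ (planeRot (0 : Fin 3) θ) r₀ := by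
  intro n F hF hFr
  -- degrees `0` and `1`: the action is trivial, resp. `S₁ 1 = 0`
  rcases Nat.lt_or_ge n 2 with hn | hn
  · interval_cases n
    · congr 1
      ext x
      rw [linActMulti_apply]
      congr 1
      exact funext fun i => Fin.elim0 i
    · rw [h1, h1]
  have hclosed : IsClosed {G : 𝓢((Fin n → E4), ℂ) | S₁ n (linActMulti (planeRot (0 : Fin 3) θ) G) = S₁ n G} :=
    isClosed_eq ((S₁ n).continuous.comp (linActMulti (planeRot (0 : Fin 3) θ)).continuous) (S₁ n).continuous
  set A : Set 𝓢((Fin n → E4), ℂ) := {G | HasCompactSupport (G : (Fin n → E4) → ℂ) ∧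
    (∃ δ : ℝ, 0 < δ ∧ tsupport (G : (Fin n → E4) → ℂ) ⊆ Separated n δ) ∧
    tsupport (G : (Fin n → E4) → ℂ) ⊆ tsupport (F : (Fin n → E4) → ℂ)} with hA
  have hsub : A ⊆ {G : 𝓢((Fin n → E4), ℂ) | S₁ n (linActMulti (planeRot (0 : Fin 3) θ) G) = S₁ n G} := by
    rintro G ⟨hGc, ⟨δ, hδ, hGδ⟩, hGF⟩
    exact orbit_eq_of_king S₁ hdens hΘ (hking n hn) G
      ⟨isOffDiagonal_of_tsupport_subset_separated hδ hGδ, hGc, ⟨δ, hδ, hGδ⟩, hGF.trans hFr⟩ θ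
  suffices hmem : F ∈ closure A from hclosed.closure_subset_iff.2 hsub hmem
  obtain ⟨u, husupp, huoff, hulim⟩ := exists_offDiagonal_cutoff_tendsto' F hF
  refine isClosed_closure.mem_of_tendsto hulim (Eventually.of_forall fun m => ?_)
  obtain ⟨v, hv, hvlim⟩ := exists_pairCutoff_tendsto (huoff m) ((husupp m).trans Set.inter_subset_right)
  refine mem_closure_of_tendsto hvlim (Eventually.of_forall fun j => ⟨?_, ⟨((j : ℝ) + 1)⁻¹, by positivity, ?_⟩, ?_⟩)
  · exact IsCompact.of_isClosed_subset (isCompact_closedBall _ _) (isClosed_tsupport _)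
      ((hv j).trans (Set.inter_subset_left.trans ((husupp m).trans Set.inter_subset_right)))
  · intro x hx
    simp only [Separated, Set.mem_setOf_eq, dist_eq_norm]
    exact ((hv j) hx).2
  · exact (hv j).trans (Set.inter_subset_left.trans ((husupp m).trans Set.inter_subset_left))

variable {G : Type} [Group G] [TopologicalSpace G] [IsTopologicalGroup G] [CompactSpace G]
  [MeasurableSpace G] [BorelSpace G]

/-- **Lattice finite-angle rotation defects → 0 along the scheme ⇒ det-1 planar germ invariance of the bundle's
limit.**  For a soft bundle whose limit has bounded densities off the diagonal: if for `n ≥ 2`, every `F` of the class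
and every angle `θ ∈ Θ` the difference of the lattice `n`-point distributions at `R_θ · F` and at `F` tends to `0`,
then (bundle convergence on `⁰𝒮` at both test functions, uniqueness of limits) `S₁ n (R_θ · F) = S₁ n F`; if `Θ`
generates a dense subgroup of the angles, every det-1 isometry of the `(x₀,x₁)`-plane fixes the germ. -/
theorem germRotAt_of_latticeKingAt (r : LatticeRep G) (a : ℝ → ℝ) (sch : SpeciesScheme (YMSpecies G))
    (S₁ : SchwingerFamily E4) (Tq : (n : ℕ) → (Fin n → Fin 4 × Fin 4) → (𝓢((Fin n → E4), ℂ) →L[ℂ] ℂ))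
    (K : ℝ) (b₀ : ℝ) (g : ℝ → ℕ → ℕ) (hB : SoftBundle G r a sch S₁ Tq K b₀ g) (hdens : OffDiagDensity S₁)
    {r₀ : ℝ} (hr₀ : 0 < r₀) {Θ : Set ℝ} (hΘ : Dense ((AddSubgroup.closure Θ : AddSubgroup ℝ) : Set ℝ))
    (hlat : ∀ (n : ℕ), 2 ≤ n → ∀ F ∈ KingClass n r₀, ∀ θ ∈ Θ,
      Tendsto (fun k =>
        latticeDist r.ρ (sch.β k) (sch.L k) (sch.a k) r.curvature.F
            (wilsonTorusMean r.ρ (sch.β k) (sch.L k) r.curvature.F) n (linActMulti (planeRot (0 : Fin 3) θ) F) -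
          latticeDist r.ρ (sch.β k) (sch.L k) (sch.a k) r.curvature.F
            (wilsonTorusMean r.ρ (sch.β k) (sch.L k) r.curvature.F) n F) atTop (𝓝 0)) :
    ∃ r₀ : ℝ, 0 < r₀ ∧ ∀ R : E4 ≃ₗᵢ[ℝ] E4, LinearMap.det (R.toLinearEquiv : E4 →ₗ[ℝ] E4) = 1 →
      IsPlanar01 R → GermInvariant S₁ R r₀ := by
  -- the bundle's one-point clause and its convergence clause on `⁰𝒮`
  obtain ⟨⟨-, -, -, -, -, -, -, -, -, hS1, hconv, -⟩, -⟩ := hB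
  have hK : ∀ (n : ℕ), 2 ≤ n → ∀ F ∈ KingClass n r₀, ∀ θ ∈ Θ,
      S₁ n (linActMulti (planeRot (0 : Fin 3) θ) F) = S₁ n F := by
    intro n hn F hF θ hθ
    have h₁ := hconv n hn (linActMulti (planeRot (0 : Fin 3) θ) F) (isOffDiagonal_linActMulti _ hF.1)
    have h₂ := hconv n hn F hF.1
    exact sub_eq_zero.1 (tendsto_nhds_unique (h₁.sub h₂) (hlat n hn F hF θ hθ))
  refine ⟨r₀, hr₀, fun R hdet hR => ?_⟩
  obtain ⟨φ, rfl⟩ := exists_eq_planeRot R hdet hR.1 hR.2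
  exact germInvariant_planeRot_of_king S₁ hdens hS1 hΘ hK φ

/-- Convenience: a dense set of angles generates a dense subgroup. -/
theorem dense_closure_of_dense {Θ : Set ℝ} (hΘ : Dense Θ) :
    Dense ((AddSubgroup.closure Θ : AddSubgroup ℝ) : Set ℝ) :=
  hΘ.mono AddSubgroup.subset_closure

/-! ### King's angle set: the Pythagorean angles are a dense subgroup -/

/-- **The Pythagorean angles** (King's rotations): both `cos θ` and `sin θ` rational — the angles of the rational
points of the unit circle.  An additive subgroup of `ℝ` (addition formulas). -/
def pythagoreanAngles : AddSubgroup ℝ where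
  carrier := {θ : ℝ | (∃ p : ℚ, Real.cos θ = p) ∧ ∃ q : ℚ, Real.sin θ = q}
  zero_mem' := ⟨⟨1, by simp⟩, ⟨0, by simp⟩⟩
  add_mem' := by
    rintro a b ⟨⟨p, hp⟩, ⟨q, hq⟩⟩ ⟨⟨p', hp'⟩, ⟨q', hq'⟩⟩
    exact ⟨⟨p * p' - q * q', by rw [Real.cos_add, hp, hq, hp', hq']; push_cast; ring⟩,
      ⟨q * p' + p * q', by rw [Real.sin_add, hp, hq, hp', hq']; push_cast; ring⟩⟩
  neg_mem' := by
    rintro a ⟨⟨p, hp⟩, ⟨q, hq⟩⟩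
    exact ⟨⟨p, by rw [Real.cos_neg, hp]⟩, ⟨-q, by rw [Real.sin_neg, hq]; push_cast; ring⟩⟩

/-- The angle of the rational point `((1−t²)/(1+t²), 2t/(1+t²))`, `0 < t < 1` rational, is Pythagorean. -/
theorem arcsin_mem_pythagoreanAngles (t : ℚ) (ht0 : 0 < (t : ℝ)) (ht1 : (t : ℝ) < 1) :
    Real.arcsin (2 * t / (1 + (t : ℝ) ^ 2)) ∈ pythagoreanAngles := by
  have h1t : (0 : ℝ) < 1 + (t : ℝ) ^ 2 := by positivity
  have hx1 : 2 * t / (1 + (t : ℝ) ^ 2) ≤ 1 := by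
    rw [div_le_one h1t]; nlinarith [sq_nonneg ((t : ℝ) - 1)]
  have hx0 : (0 : ℝ) ≤ 2 * t / (1 + (t : ℝ) ^ 2) := by positivity
  refine ⟨⟨(1 - t ^ 2) / (1 + t ^ 2), ?_⟩, ⟨2 * t / (1 + t ^ 2), ?_⟩⟩
  · rw [Real.cos_arcsin]
    have hid : 1 - (2 * t / (1 + (t : ℝ) ^ 2)) ^ 2 = ((1 - (t : ℝ) ^ 2) / (1 + (t : ℝ) ^ 2)) ^ 2 := by
      field_simp
      ring
    rw [hid, Real.sqrt_sq (div_nonneg (by nlinarith) h1t.le)]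
    push_cast
    rfl
  · rw [Real.sin_arcsin (by linarith) hx1]
    push_cast
    rfl

/-- **The Pythagorean angles are dense in `ℝ`** (rational points are dense on the circle; here: the angles
`arcsin (2t/(1+t²))`, `t → 0⁺` rational, are Pythagorean, positive and small, so the subgroup has no isolated zero —
Mathlib `AddSubgroup.dense_of_not_isolated_zero`).  No irrationality of `arctan(3/4)/π` is needed. -/
theorem dense_pythagoreanAngles : Dense (pythagoreanAngles : Set ℝ) := by
  refine AddSubgroup.dense_of_not_isolated_zero _ fun ε hε => ?_
  set y : ℝ := min ε 1 with hy
  have hy0 : 0 < y := lt_min hε one_pos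
  have hy1 : y ≤ 1 := min_le_right _ _
  have hyπ : y ≤ Real.pi / 2 := hy1.trans (by linarith [Real.pi_gt_three])
  have hsy : 0 < Real.sin y := Real.sin_pos_of_pos_of_lt_pi hy0 (by linarith [Real.pi_gt_three])
  obtain ⟨t, ht0, ht1⟩ := exists_rat_btwn (show (0 : ℝ) < min (Real.sin y / 2) (1 / 2) from
    lt_min (by linarith) (by norm_num))
  have hts : (t : ℝ) < Real.sin y / 2 := ht1.trans_le (min_le_left _ _)
  have hth : (t : ℝ) < 1 / 2 := ht1.trans_le (min_le_right _ _)
  have h1t : (0 : ℝ) < 1 + (t : ℝ) ^ 2 := by positivity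
  set x : ℝ := 2 * t / (1 + (t : ℝ) ^ 2) with hx
  have hx0 : 0 < x := by positivity
  have hxle : x ≤ 2 * t := by
    rw [hx, div_le_iff₀ h1t]; nlinarith
  have hxsin : x < Real.sin y := by linarith
  refine ⟨Real.arcsin x, arcsin_mem_pythagoreanAngles t ht0 (by linarith), Real.arcsin_pos.2 hx0, ?_⟩
  have hlt : Real.arcsin x < y :=
    (Real.arcsin_lt_iff_lt_sin' ⟨by linarith [Real.pi_gt_three], hyπ⟩).2 hxsin
  exact hlt.trans_le (min_le_left _ _)

/-- Hence King's angle set qualifies for the `KING` leg: it generates (indeed is) a dense subgroup. -/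
theorem dense_closure_pythagoreanAngles :
    Dense ((AddSubgroup.closure (pythagoreanAngles : Set ℝ) : AddSubgroup ℝ) : Set ℝ) := by
  rw [AddSubgroup.closure_eq]
  exact dense_pythagoreanAngles

/-- The (3,4,5) angle is Pythagorean: `cos θ₀ = 4/5`, `sin θ₀ = 3/5` for `θ₀ = arcsin (3/5)`. -/
theorem arcsin_three_fifths_mem : Real.arcsin (3 / 5) ∈ pythagoreanAngles := by
  have h := arcsin_mem_pythagoreanAngles (1 / 3) (by norm_num) (by norm_num)
  have he : (2 * ((1 / 3 : ℚ) : ℝ) / (1 + (((1 / 3 : ℚ) : ℝ)) ^ 2)) = 3 / 5 := by push_cast; norm_num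
  rwa [he] at h

end King

section BindersKing

variable (G : Type) [Group G] [TopologicalSpace G] [IsTopologicalGroup G] [CompactSpace G]
  [MeasurableSpace G] [BorelSpace G] (r : LatticeRep G) (a : ℝ → ℝ)

/-- **KING Θ** — E1 in King's lattice form: along every scheme in units `a` with `β_k → ∞` and the soft-bundle torus
ranges there is `r₀ > 0` such that for `n ≥ 2`, every test function `F` of the class `King.KingClass n r₀`
(off-diagonal, compactly supported, separated, diameter `< r₀`) and every angle `θ ∈ Θ`, the centred,
`a⁻⁴`-renormalised lattice `n`-point distributions at `R_θ · F` and at `F` differ by `o(1)` as `k → ∞`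
(`R_θ = planeRot 0 θ`, the rotation of the `(x₀,x₁)`-plane).  A deliverer à la King takes `Θ` = the Pythagorean
angles (rational points of the circle); the bridge only needs `Θ` to generate a dense subgroup of the angles. -/
def LatticeKingWard (Θ : Set ℝ) : Prop :=
  ∀ (sch : SpeciesScheme (YMSpecies G)), (∀ k, sch.a k = a (sch.β k)) → Tendsto sch.β atTop atTop →
    (∀ k, 0 ≤ sch.β k ∧ sch.a k ≤ 1 / 24 ∧ 14 ≤ sch.L k ∧ (sch.a k)⁻¹ * (sch.a k)⁻¹ ≤ sch.L k) →
      ∃ r₀ : ℝ, 0 < r₀ ∧ ∀ (n : ℕ), 2 ≤ n → ∀ F ∈ King.KingClass n r₀, ∀ θ ∈ Θ,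
        Tendsto (fun k =>
          latticeDist r.ρ (sch.β k) (sch.L k) (sch.a k) r.curvature.F
              (wilsonTorusMean r.ρ (sch.β k) (sch.L k) r.curvature.F) n (linActMulti (planeRot (0 : Fin 3) θ) F) -
            latticeDist r.ρ (sch.β k) (sch.L k) (sch.a k) r.curvature.F
              (wilsonTorusMean r.ρ (sch.β k) (sch.L k) r.curvature.F) n F) atTop (𝓝 0)

/-- **KING Θ** (abbreviation used in the bridge). -/
abbrev KING (Θ : Set ℝ) : Prop := LatticeKingWard G r a Θ

end BindersKing

end Summit.QuantumFields.YangMills.Cruxes.OSLegsAtWeakCouplingC.Y2Bridge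

end
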